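/-
Copyright (c) 2026 the pub-hodgecm-mathlib formalisation cell (harness21).  Prover seat hodgecm-mathlib-K2E3-p23 (g6), HCML Track B «K2-LIT» ∕ h413
(`stmt-HodgeConjecture-24833`), line `K2_E3_EllipticInputs`, leaf (nsc-S-A′) `sig_K2E3GL3PrincipalBlockStandardSpan`, H-layer tool brick UNIQ of the architect's
`MEMO-SA-architecture.v2.K2E3-p25-g2.md` §1 (architect K2E3-p25 (g2); dealer K2E3-plan (g4) D87).  2026-09-04.
-/
import Summits.HodgeConjecture.HodgeConjecture.Theorems.K2E3GL3JacquetMultiplicityAdditive   -- ★ ADD (K2E3-p17 g8): additivity ∕ monotonicity ∕ `Equiv`-invariance of `mult`, `r_B` f.d. along subs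
import Summits.HodgeConjecture.HodgeConjecture.Theorems.K2E3GL3EmbeddingOfWeight             -- ★ EMB (K2E3-p17 g8): `exists_injective_intertwiningMap_parabolicIndGL`
import Summits.HodgeConjecture.HodgeConjecture.Theorems.K2E3GL3PrincipalSeriesExponents      -- ★ H0-a (K2E3-p25 g0): `r_B (I θ)` f.d. and `mult (I θ) η = #{w : η = tch(θ∘w⁻¹)}`
import Literature.NumberTheory.Automorphic.IrreducibleClasses                                  -- ★ `Representation.Equiv.isIrreducible`
import HarnessLib

/-!
# Crux `H413` — leaf (nsc-S-A′), H-layer tool UNIQ: an exponent of MULTIPLICITY ONE is carried by at most one irreducible subrepresentation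

Cell `hodgecm-mathlib`, Track B; THEOREMS ONLY; count-neutral helper (`--supports stmt-HodgeConjecture-24833 --as helper`).  Currency (CONVENTIONS 08:40Z, MEMO v2 §0):
`LB n = Π a : Fin n, GL {i // id i = a} F`, `r_B V = (restrictUnipotentGL F id V).Coinvariants`, `mult V η = finrank ℂ ↥(⨅ m, maxGenEigenspace (normalizedJacquetGL F id V m) (η m))`
(written inline; no definition), `I χ = parabolicIndGL F id (𝟙.twist χ)`, `tch θ = ∏ a, (θ a) ∘ det ∘ ev_a`.

THE MATHEMATICS ([BernsteinZelevinsky1977, §2.3, Cor. 2.13]; [Casselman1995, §6.3]).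
* §1 (any `n`) **`inf_eq_bot_or_eq_of_isIrreducible`** — two irreducible subrepresentations meet trivially or coincide; **`eq_of_finrank_weightSpace_eq_one`** (UNIQ (a)):
  for `V` smooth with `r_B V` finite-dimensional, two IRREDUCIBLE subrepresentations `N₁, N₂` each carrying the exponent `η` (`mult Nᵢ η ≠ 0`) of a weight of
  MULTIPLICITY ONE in `V` (`mult V η = 1`) are EQUAL — otherwise `N₁ ⊓ N₂ = ⊥`, `N₁ ⊕ N₂ ≅ N₁ ⊔ N₂ ≤ V` and ★ ADD additivity gives `mult (N₁ ⊔ N₂) η ≥ 2 > 1`.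
* §2 (any `n`) **`nonempty_equiv_of_finrank_weightSpace_eq_one`** (UNIQ (b)): two irreducible smooth `ρ₁, ρ₂` with `r_B` finite-dimensional, both carrying `⇑χ`, where
  `mult (I χ) ⇑χ = 1`, are ISOMORPHIC — ★ EMB embeds both into `I χ`, §1 identifies the images (irreducible by ★ `Equiv.isIrreducible`), and `ρ₁ ≅ range Φ₁ = range Φ₂ ≅ ρ₂`.
* §3 (`n = 3`, `tch`-currency) the same with `r_B (I θ)` finite-dimensional by ★ H0-a and `mult (I θ) (tch θ) = 1` read off ★ H0-a for a REGULAR `θ`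
  (`#{w ∈ S₃ : tch θ = tch (θ ∘ w⁻¹)} = 1`): **`nonempty_equiv_of_regular_three`**.

HONEST LABEL: HC_CM is proved only modulo the 7 printed citations (2 remaining named inputs: hLiu418 = stmt-HodgeConjecture-24832, h413 = stmt-HodgeConjecture-24833) until
rung 0 closes; count-neutral helper, closes no socket.

## References
* [BernsteinZelevinsky1977] I. N. Bernstein, A. V. Zelevinsky, *Induced representations of reductive p-adic groups I*, Ann. Sci. ÉNS 10 (1977), Prop. 1.9, §2.3, Cor. 2.13.
* [Casselman1995] W. Casselman, *Introduction to the theory of admissible representations of p-adic reductive groups* (draft 1995), §6.3 (Thm. 6.3.5 ff.).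
-/

set_option autoImplicit false
-- the mandated namespace repeats `HodgeConjecture.HodgeConjecture`, as in every `Theorems/*.lean` of this sub-problem
set_option linter.dupNamespace false

noncomputable section

open Representation Module Function Literature.NumberTheory.Automorphic Literature.NumberTheory.GaloisRepresentations.IsNonarchimedeanLocalField
open scoped MatrixGroups
open Summit.HodgeConjecture.HodgeConjecture.Cruxes.H413.K2E3GL3JacquetMultiplicityAdditive
open Summit.HodgeConjecture.HodgeConjecture.Cruxes.H413.K2E3GL3EmbeddingOfWeight (exists_injective_intertwiningMap_parabolicIndGL)
open Summit.HodgeConjecture.HodgeConjecture.Cruxes.H413.K2E3GL3PrincipalSeriesExponents (finrank_weightSpace_principalSeries_three_tch)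

namespace Summit.HodgeConjecture.HodgeConjecture.Cruxes.H413.K2E3GL3WeightOneUniqueness

/-! ## §1 UNIQ (a): a multiplicity-one exponent singles out the irreducible subrepresentation carrying it -/

section Sub

universe v

variable {F : Type*} [Field F] [ValuativeRel F] [TopologicalSpace F] [IsNonarchimedeanLocalField F] {n : ℕ}
  {X : Type v} [AddCommGroup X] [Module ℂ X] (V : Representation ℂ (GL (Fin n) F) X)

omit [ValuativeRel F] [TopologicalSpace F] [IsNonarchimedeanLocalField F] in
/-- **Two IRREDUCIBLE subrepresentations either meet trivially or coincide** (`N₁ ⊓ N₂` is a subrepresentation of the irreducible `N₁`, and `N₁ ≤ N₂` inside the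
irreducible `N₂` forces `N₁ = N₂`, `N₁` being non-zero). [folklore] -/
theorem inf_eq_bot_or_eq_of_isIrreducible (N₁ N₂ : Subrepresentation V) [N₁.toRepresentation.IsIrreducible] [N₂.toRepresentation.IsIrreducible] :
    N₁ ⊓ N₂ = ⊥ ∨ N₁ = N₂ := by
  -- `N₁ ⊓ N₂` read inside `N₁`
  let M : Subrepresentation N₁.toRepresentation :=
    ⟨N₂.toSubmodule.comap N₁.toSubmodule.subtype, fun g _ hx => N₂.apply_mem_toSubmodule g hx⟩
  rcases IsSimpleOrder.eq_bot_or_eq_top M with hM | hM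
  · refine Or.inl (le_bot_iff.1 fun v hv => ?_)
    have hvM : (⟨v, hv.1⟩ : ↥N₁.toSubmodule) ∈ M := hv.2
    rw [hM] at hvM
    have h0 : (⟨v, hv.1⟩ : ↥N₁.toSubmodule) = 0 := hvM
    exact congrArg Subtype.val h0
  · -- `N₁ ≤ N₂`; read `N₁` inside `N₂`
    have h12 : N₁ ≤ N₂ := fun v hv => by
      have hvM : (⟨v, hv⟩ : ↥N₁.toSubmodule) ∈ M := by rw [hM]; trivial
      exact hvM
    let M' : Subrepresentation N₂.toRepresentation :=
      ⟨N₁.toSubmodule.comap N₂.toSubmodule.subtype, fun g _ hx => N₁.apply_mem_toSubmodule g hx⟩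
    rcases IsSimpleOrder.eq_bot_or_eq_top M' with hM' | hM'
    · exfalso
      haveI : Nontrivial ↥N₁.toSubmodule := IrrClass.nontrivial_of_isIrreducible N₁.toRepresentation
      obtain ⟨w, hw⟩ := exists_ne (0 : ↥N₁.toSubmodule)
      have hwM' : (⟨(w : X), h12 w.2⟩ : ↥N₂.toSubmodule) ∈ M' := w.2
      rw [hM'] at hwM'
      have h0 : (⟨(w : X), h12 w.2⟩ : ↥N₂.toSubmodule) = 0 := hwM'
      have h0' : (w : X) = 0 := congrArg Subtype.val h0
      exact hw (Subtype.ext h0')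
    · refine Or.inr (le_antisymm h12 fun v hv => ?_)
      have hvM' : (⟨v, hv⟩ : ↥N₂.toSubmodule) ∈ M' := by rw [hM']; trivial
      exact hvM'

/-- **UNIQ (a): AN EXPONENT OF MULTIPLICITY ONE IS CARRIED BY AT MOST ONE IRREDUCIBLE SUBREPRESENTATION.**  For `V` smooth on `GL_n(F)` with `r_B V` finite-dimensional,
irreducible subrepresentations `N₁, N₂` with `mult N₁ η ≠ 0`, `mult N₂ η ≠ 0` and `mult V η = 1` are EQUAL: otherwise `N₁ ⊓ N₂ = ⊥` (§1), so
`(N₁ ⊔ N₂) ⁄ N₁ ≅ N₂` and ★ ADD gives `mult (N₁ ⊔ N₂) η = mult N₁ η + mult N₂ η ≥ 2`, against `mult (N₁ ⊔ N₂) η ≤ mult V η = 1`.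
[cite: BernsteinZelevinsky1977, Cor. 2.13, §2.3] [cite: Casselman1995, §6.3] -/
theorem eq_of_finrank_weightSpace_eq_one (hV : V.IsSmooth) [FiniteDimensional ℂ (restrictUnipotentGL F (id : Fin n → Fin n) V).Coinvariants]
    {N₁ N₂ : Subrepresentation V} [N₁.toRepresentation.IsIrreducible] [N₂.toRepresentation.IsIrreducible]
    (η : (Π a : Fin n, GL {i : Fin n // (id : Fin n → Fin n) i = a} F) → ℂ)
    (h1 : finrank ℂ ↥(⨅ m, Module.End.maxGenEigenspace (normalizedJacquetGL F (id : Fin n → Fin n) V m) (η m)) = 1)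
    (hN₁ : finrank ℂ ↥(⨅ m, Module.End.maxGenEigenspace (normalizedJacquetGL F (id : Fin n → Fin n) N₁.toRepresentation m) (η m)) ≠ 0)
    (hN₂ : finrank ℂ ↥(⨅ m, Module.End.maxGenEigenspace (normalizedJacquetGL F (id : Fin n → Fin n) N₂.toRepresentation m) (η m)) ≠ 0) :
    N₁ = N₂ := by
  rcases inf_eq_bot_or_eq_of_isIrreducible V N₁ N₂ with hinf | h
  swap
  · exact h
  exfalso
  -- `S = N₁ ⊔ N₂`, smooth with `r_B S` finite-dimensional; `N₁' ≤ S` the copy of `N₁`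
  have hSs : (N₁ ⊔ N₂).toRepresentation.IsSmooth := hV.toRepresentation (N₁ ⊔ N₂)
  haveI : FiniteDimensional ℂ (restrictUnipotentGL F (id : Fin n → Fin n) (N₁ ⊔ N₂).toRepresentation).Coinvariants :=
    finiteDimensional_jacquet_subrepresentation V monotone_id hV (N₁ ⊔ N₂)
  let N₁' : Subrepresentation (N₁ ⊔ N₂).toRepresentation :=
    ⟨N₁.toSubmodule.comap (N₁ ⊔ N₂).toSubmodule.subtype, fun g _ hx => N₁.apply_mem_toSubmodule g hx⟩
  have e₁ : N₁'.toRepresentation.Equiv N₁.toRepresentation :=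
    Representation.Equiv.mk (Submodule.comapSubtypeEquivOfLe (le_sup_left : N₁ ≤ N₁ ⊔ N₂)) fun g => LinearMap.ext fun _ => rfl
  -- `N₂ → S ⁄ N₁'` is an isomorphism of representations
  let ι : N₂.toRepresentation.IntertwiningMap (N₁ ⊔ N₂).toRepresentation :=
    { toLinearMap := Submodule.inclusion (show N₂.toSubmodule ≤ (N₁ ⊔ N₂).toSubmodule from le_sup_right)
      isIntertwining' := fun g => LinearMap.ext fun _ => rfl }
  let f : N₂.toRepresentation.IntertwiningMap N₁'.quotientRep := N₁'.mkQ.comp ι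
  have hf_inj : Function.Injective f := by
    intro a b hab
    rw [← sub_eq_zero] at hab ⊢
    rw [← map_sub] at hab
    have hmem : ι (a - b) ∈ N₁' := (N₁'.mkQ_eq_zero_iff _).1 hab
    have hmem' : ((a - b : ↥N₂.toSubmodule) : X) ∈ N₁ ⊓ N₂ := ⟨hmem, (a - b).2⟩
    rw [hinf] at hmem'
    exact Subtype.ext hmem'
  have hf_surj : Function.Surjective f := by
    intro y
    obtain ⟨w, rfl⟩ := N₁'.mkQ_surjective y
    obtain ⟨a, ha, b, hb, hab⟩ := Submodule.mem_sup.1 w.2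
    refine ⟨⟨b, hb⟩, ?_⟩
    have hw : w = ⟨a, le_sup_left (a := N₁.toSubmodule) ha⟩ + ⟨b, le_sup_right (b := N₂.toSubmodule) hb⟩ := Subtype.ext hab.symm
    have ha0 : N₁'.mkQ (⟨a, le_sup_left (a := N₁.toSubmodule) ha⟩ : ↥(N₁ ⊔ N₂).toSubmodule) = 0 := (N₁'.mkQ_eq_zero_iff _).2 ha
    rw [hw, map_add, ha0, zero_add]
    rfl
  have e₂ : N₂.toRepresentation.Equiv N₁'.quotientRep := Representation.IntertwiningMap.ofBijective f ⟨hf_inj, hf_surj⟩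
  -- count
  have hadd := finrank_weightSpace_eq_add_subrepresentation (N₁ ⊔ N₂).toRepresentation hSs N₁' η
  have hle := finrank_weightSpace_subrepresentation_le V hV (N₁ ⊔ N₂) η
  rw [finrank_weightSpace_eq_of_equiv _ _ e₁ η, ← finrank_weightSpace_eq_of_equiv _ _ e₂ η] at hadd
  omega

end Sub

/-! ## §2 UNIQ (b): irreducibles carrying a multiplicity-one exponent of `I χ` are isomorphic -/

section Irrep

variable {F : Type} [Field F] [ValuativeRel F] [TopologicalSpace F] [IsNonarchimedeanLocalField F] {n : ℕ}
  {V₁ V₂ : Type} [AddCommGroup V₁] [Module ℂ V₁] [AddCommGroup V₂] [Module ℂ V₂]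
  (ρ₁ : Representation ℂ (GL (Fin n) F) V₁) (ρ₂ : Representation ℂ (GL (Fin n) F) V₂)

/-- **UNIQ (b): TWO IRREDUCIBLES CARRYING A MULTIPLICITY-ONE EXPONENT OF `I χ` ARE ISOMORPHIC.**  For `ρ₁, ρ₂` irreducible smooth on `GL_n(F)` with `r_B ρᵢ`
finite-dimensional, a character `χ` of the diagonal torus with `mult ρᵢ ⇑χ ≠ 0` (`i = 1, 2`), `r_B (I χ)` finite-dimensional and `mult (I χ) ⇑χ = 1`:
`ρ₁ ≅ ρ₂` — ★ EMB embeds `ρᵢ ↪ I χ`, the images are irreducible subrepresentations carrying `⇑χ` (★ ADD `Equiv`-invariance), hence EQUAL by UNIQ (a), and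
`ρ₁ ≅ range Φ₁ = range Φ₂ ≅ ρ₂` (`LinearEquiv.ofInjective`). [cite: BernsteinZelevinsky1977, Prop. 1.9 (b), Cor. 2.13] [cite: Casselman1995, §6.3] -/
theorem nonempty_equiv_of_finrank_weightSpace_eq_one [ρ₁.IsIrreducible] [ρ₂.IsIrreducible] (h₁ : ρ₁.IsSmooth) (h₂ : ρ₂.IsSmooth)
    [FiniteDimensional ℂ (restrictUnipotentGL F (id : Fin n → Fin n) ρ₁).Coinvariants]
    [FiniteDimensional ℂ (restrictUnipotentGL F (id : Fin n → Fin n) ρ₂).Coinvariants]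
    (χ : (Π a : Fin n, GL {i : Fin n // (id : Fin n → Fin n) i = a} F) →* ℂˣ)
    [FiniteDimensional ℂ (restrictUnipotentGL F (id : Fin n → Fin n) (parabolicIndGL F (id : Fin n → Fin n)
      ((Representation.trivial ℂ (Π a : Fin n, GL {i : Fin n // (id : Fin n → Fin n) i = a} F) ℂ).twist χ))).Coinvariants]
    (hI : finrank ℂ ↥(⨅ m, Module.End.maxGenEigenspace (normalizedJacquetGL F (id : Fin n → Fin n) (parabolicIndGL F (id : Fin n → Fin n)
      ((Representation.trivial ℂ (Π a : Fin n, GL {i : Fin n // (id : Fin n → Fin n) i = a} F) ℂ).twist χ)) m) ((χ m : ℂˣ) : ℂ)) = 1)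
    (hρ₁ : finrank ℂ ↥(⨅ m, Module.End.maxGenEigenspace (normalizedJacquetGL F (id : Fin n → Fin n) ρ₁ m) ((χ m : ℂˣ) : ℂ)) ≠ 0)
    (hρ₂ : finrank ℂ ↥(⨅ m, Module.End.maxGenEigenspace (normalizedJacquetGL F (id : Fin n → Fin n) ρ₂ m) ((χ m : ℂˣ) : ℂ)) ≠ 0) :
    Nonempty (ρ₁.Equiv ρ₂) := by
  obtain ⟨Φ₁, hΦ₁⟩ := exists_injective_intertwiningMap_parabolicIndGL ρ₁ h₁ χ hρ₁
  obtain ⟨Φ₂, hΦ₂⟩ := exists_injective_intertwiningMap_parabolicIndGL ρ₂ h₂ χ hρ₂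
  have hIs : (parabolicIndGL F (id : Fin n → Fin n)
      ((Representation.trivial ℂ (Π a : Fin n, GL {i : Fin n // (id : Fin n → Fin n) i = a} F) ℂ).twist χ)).IsSmooth :=
    Representation.isSmooth_smoothInd _ _
  -- the images
  have e₁ : ρ₁.Equiv Φ₁.range.toRepresentation :=
    Representation.Equiv.mk (LinearEquiv.ofInjective Φ₁.toLinearMap hΦ₁) fun g => LinearMap.ext fun v => Subtype.ext (by
      change Φ₁ (ρ₁ g v) = _
      exact Representation.IntertwiningMap.isIntertwining ρ₁ _ Φ₁ g v)
  have e₂ : ρ₂.Equiv Φ₂.range.toRepresentation :=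
    Representation.Equiv.mk (LinearEquiv.ofInjective Φ₂.toLinearMap hΦ₂) fun g => LinearMap.ext fun v => Subtype.ext (by
      change Φ₂ (ρ₂ g v) = _
      exact Representation.IntertwiningMap.isIntertwining ρ₂ _ Φ₂ g v)
  haveI : Φ₁.range.toRepresentation.IsIrreducible := e₁.isIrreducible
  haveI : Φ₂.range.toRepresentation.IsIrreducible := e₂.isIrreducible
  have hR₁ := hρ₁
  have hR₂ := hρ₂
  rw [finrank_weightSpace_eq_of_equiv _ _ e₁] at hR₁
  rw [finrank_weightSpace_eq_of_equiv _ _ e₂] at hR₂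
  have hR : Φ₁.range = Φ₂.range := eq_of_finrank_weightSpace_eq_one _ hIs (fun m => ((χ m : ℂˣ) : ℂ)) hI hR₁ hR₂
  -- transport along the equality of ranges
  have e₁₂ : Φ₁.range.toRepresentation.Equiv Φ₂.range.toRepresentation :=
    Representation.Equiv.mk (LinearEquiv.ofEq _ _ (congrArg Subrepresentation.toSubmodule hR)) fun g => LinearMap.ext fun _ => rfl
  exact ⟨(e₁.trans e₁₂).trans e₂.symm⟩

end Irrep

/-! ## §3 `n = 3`, `tch`-currency: a REGULAR triple `θ` -/

section Three

variable {F : Type} [Field F] [ValuativeRel F] [TopologicalSpace F] [IsNonarchimedeanLocalField F]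
  {V₁ V₂ : Type} [AddCommGroup V₁] [Module ℂ V₁] [AddCommGroup V₂] [Module ℂ V₂]
  (ρ₁ : Representation ℂ (GL (Fin 3) F) V₁) (ρ₂ : Representation ℂ (GL (Fin 3) F) V₂)

open scoped Classical in
/-- **UNIQ (b) for `GL₃`, `tch`-currency**: for `θ : Fin 3 → (Fˣ →* ℂˣ)` with `ker (tch θ)` open and `θ` REGULAR (`#{w ∈ S₃ : tch θ = tch (θ ∘ w⁻¹)} = 1`, so that
`mult (I θ) (tch θ) = 1` by ★ H0-a), two irreducible smooth `ρ₁, ρ₂` with `r_B` finite-dimensional and `mult ρᵢ (tch θ) ≠ 0` are ISOMORPHIC.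
[cite: BernsteinZelevinsky1977, Prop. 1.9 (b), Cor. 2.13, Thm. 5.2] [cite: Casselman1995, Thm. 6.3.5, §6.3] -/
theorem nonempty_equiv_of_regular_three [ρ₁.IsIrreducible] [ρ₂.IsIrreducible] (h₁ : ρ₁.IsSmooth) (h₂ : ρ₂.IsSmooth)
    [FiniteDimensional ℂ (restrictUnipotentGL F (id : Fin 3 → Fin 3) ρ₁).Coinvariants]
    [FiniteDimensional ℂ (restrictUnipotentGL F (id : Fin 3 → Fin 3) ρ₂).Coinvariants]
    (θ : Fin 3 → (Fˣ →* ℂˣ))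
    (hθ : IsOpen (((∏ a : Fin 3, (θ a).comp (Matrix.GeneralLinearGroup.det.comp
      (Pi.evalMonoidHom (fun a : Fin 3 => GL {i : Fin 3 // (id : Fin 3 → Fin 3) i = a} F) a)))).ker :
        Set (Π a : Fin 3, GL {i : Fin 3 // (id : Fin 3 → Fin 3) i = a} F)))
    (hreg : ((Finset.univ : Finset (Equiv.Perm (Fin 3))).filter fun w =>
        (fun m : (Π a : Fin 3, GL {i : Fin 3 // (id : Fin 3 → Fin 3) i = a} F) =>
          (((∏ a : Fin 3, (θ a).comp (Matrix.GeneralLinearGroup.det.comp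
            (Pi.evalMonoidHom (fun a : Fin 3 => GL {i : Fin 3 // (id : Fin 3 → Fin 3) i = a} F) a))) m : ℂˣ) : ℂ)) =
        fun m => (((∏ a : Fin 3, ((fun a => θ (w.symm a)) a).comp ((Matrix.GeneralLinearGroup.det : GL {i : Fin 3 // (id : Fin 3 → Fin 3) i = a} F →* Fˣ).comp
            (Pi.evalMonoidHom (fun b : Fin 3 => GL {i : Fin 3 // (id : Fin 3 → Fin 3) i = b} F) a))) m : ℂˣ) : ℂ)).card = 1)
    (hρ₁ : finrank ℂ ↥(⨅ m, Module.End.maxGenEigenspace (normalizedJacquetGL F (id : Fin 3 → Fin 3) ρ₁ m)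
      ((((∏ a : Fin 3, (θ a).comp (Matrix.GeneralLinearGroup.det.comp
        (Pi.evalMonoidHom (fun a : Fin 3 => GL {i : Fin 3 // (id : Fin 3 → Fin 3) i = a} F) a))) m : ℂˣ) : ℂ))) ≠ 0)
    (hρ₂ : finrank ℂ ↥(⨅ m, Module.End.maxGenEigenspace (normalizedJacquetGL F (id : Fin 3 → Fin 3) ρ₂ m)
      ((((∏ a : Fin 3, (θ a).comp (Matrix.GeneralLinearGroup.det.comp
        (Pi.evalMonoidHom (fun a : Fin 3 => GL {i : Fin 3 // (id : Fin 3 → Fin 3) i = a} F) a))) m : ℂˣ) : ℂ))) ≠ 0) :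
    Nonempty (ρ₁.Equiv ρ₂) := by
  obtain ⟨hfd, hmult⟩ := finrank_weightSpace_principalSeries_three_tch θ hθ
    (fun m => (((∏ a : Fin 3, (θ a).comp (Matrix.GeneralLinearGroup.det.comp
      (Pi.evalMonoidHom (fun a : Fin 3 => GL {i : Fin 3 // (id : Fin 3 → Fin 3) i = a} F) a))) m : ℂˣ) : ℂ))
  haveI : FiniteDimensional ℂ (restrictUnipotentGL F (id : Fin 3 → Fin 3) (parabolicIndGL F (id : Fin 3 → Fin 3)
      ((Representation.trivial ℂ (Π a : Fin 3, GL {i : Fin 3 // (id : Fin 3 → Fin 3) i = a} F) ℂ).twist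
        (∏ a : Fin 3, (θ a).comp (Matrix.GeneralLinearGroup.det.comp
          (Pi.evalMonoidHom (fun a : Fin 3 => GL {i : Fin 3 // (id : Fin 3 → Fin 3) i = a} F) a)))))).Coinvariants := hfd
  rw [hreg] at hmult
  exact nonempty_equiv_of_finrank_weightSpace_eq_one ρ₁ ρ₂ h₁ h₂ _ hmult hρ₁ hρ₂

end Three

/-! ## §4 (ED. 2, append-only) DISJOINT SUBREPRESENTATIONS ADD UP; UNIQ (a) in PIGEONHOLE form — for the C1′∕C1″ census of K2E3-p17 (g8) -/

section Pigeonhole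

universe v

variable {F : Type*} [Field F] [ValuativeRel F] [TopologicalSpace F] [IsNonarchimedeanLocalField F] {n : ℕ}
  {X : Type v} [AddCommGroup X] [Module ℂ X] (V : Representation ℂ (GL (Fin n) F) X)

/-- **DISJOINT SUBREPRESENTATIONS ADD UP**: for `V` smooth on `GL_n(F)` with `r_B V` finite-dimensional and subrepresentations `N₁, N₂` with `N₁ ⊓ N₂ = ⊥` (no irreducibility
needed), `mult N₁ η + mult N₂ η ≤ mult V η` for every `η` — `N₂ ≅ (N₁ ⊔ N₂) ⁄ N₁` by an explicit bijective intertwiner, so ★ ADD gives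
`mult N₁ η + mult N₂ η = mult (N₁ ⊔ N₂) η ≤ mult V η`. [cite: BernsteinZelevinsky1977, Cor. 2.13, §2.3] [cite: Casselman1995, §6.3] -/
theorem finrank_weightSpace_add_le_of_inf_eq_bot (hV : V.IsSmooth) [FiniteDimensional ℂ (restrictUnipotentGL F (id : Fin n → Fin n) V).Coinvariants]
    {N₁ N₂ : Subrepresentation V} (hinf : N₁ ⊓ N₂ = ⊥) (η : (Π a : Fin n, GL {i : Fin n // (id : Fin n → Fin n) i = a} F) → ℂ) :
    finrank ℂ ↥(⨅ m, Module.End.maxGenEigenspace (normalizedJacquetGL F (id : Fin n → Fin n) N₁.toRepresentation m) (η m)) +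
        finrank ℂ ↥(⨅ m, Module.End.maxGenEigenspace (normalizedJacquetGL F (id : Fin n → Fin n) N₂.toRepresentation m) (η m)) ≤
      finrank ℂ ↥(⨅ m, Module.End.maxGenEigenspace (normalizedJacquetGL F (id : Fin n → Fin n) V m) (η m)) := by
  have hSs : (N₁ ⊔ N₂).toRepresentation.IsSmooth := hV.toRepresentation (N₁ ⊔ N₂)
  haveI : FiniteDimensional ℂ (restrictUnipotentGL F (id : Fin n → Fin n) (N₁ ⊔ N₂).toRepresentation).Coinvariants :=
    finiteDimensional_jacquet_subrepresentation V monotone_id hV (N₁ ⊔ N₂)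
  let N₁' : Subrepresentation (N₁ ⊔ N₂).toRepresentation :=
    ⟨N₁.toSubmodule.comap (N₁ ⊔ N₂).toSubmodule.subtype, fun g _ hx => N₁.apply_mem_toSubmodule g hx⟩
  have e₁ : N₁'.toRepresentation.Equiv N₁.toRepresentation :=
    Representation.Equiv.mk (Submodule.comapSubtypeEquivOfLe (le_sup_left : N₁ ≤ N₁ ⊔ N₂)) fun g => LinearMap.ext fun _ => rfl
  let ι : N₂.toRepresentation.IntertwiningMap (N₁ ⊔ N₂).toRepresentation :=
    { toLinearMap := Submodule.inclusion (show N₂.toSubmodule ≤ (N₁ ⊔ N₂).toSubmodule from le_sup_right)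
      isIntertwining' := fun g => LinearMap.ext fun _ => rfl }
  let f : N₂.toRepresentation.IntertwiningMap N₁'.quotientRep := N₁'.mkQ.comp ι
  have hf_inj : Function.Injective f := by
    intro a b hab
    rw [← sub_eq_zero] at hab ⊢
    rw [← map_sub] at hab
    have hmem : ι (a - b) ∈ N₁' := (N₁'.mkQ_eq_zero_iff _).1 hab
    have hmem' : ((a - b : ↥N₂.toSubmodule) : X) ∈ N₁ ⊓ N₂ := ⟨hmem, (a - b).2⟩
    rw [hinf] at hmem'
    exact Subtype.ext hmem'
  have hf_surj : Function.Surjective f := by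
    intro y
    obtain ⟨w, rfl⟩ := N₁'.mkQ_surjective y
    obtain ⟨a, ha, b, hb, hab⟩ := Submodule.mem_sup.1 w.2
    refine ⟨⟨b, hb⟩, ?_⟩
    have hw : w = ⟨a, le_sup_left (a := N₁.toSubmodule) ha⟩ + ⟨b, le_sup_right (b := N₂.toSubmodule) hb⟩ := Subtype.ext hab.symm
    have ha0 : N₁'.mkQ (⟨a, le_sup_left (a := N₁.toSubmodule) ha⟩ : ↥(N₁ ⊔ N₂).toSubmodule) = 0 := (N₁'.mkQ_eq_zero_iff _).2 ha
    rw [hw, map_add, ha0, zero_add]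
    rfl
  have e₂ : N₂.toRepresentation.Equiv N₁'.quotientRep := Representation.IntertwiningMap.ofBijective f ⟨hf_inj, hf_surj⟩
  have hadd := finrank_weightSpace_eq_add_subrepresentation (N₁ ⊔ N₂).toRepresentation hSs N₁' η
  have hle := finrank_weightSpace_subrepresentation_le V hV (N₁ ⊔ N₂) η
  rw [finrank_weightSpace_eq_of_equiv _ _ e₁ η, ← finrank_weightSpace_eq_of_equiv _ _ e₂ η] at hadd
  omega

/-- **UNIQ (a), PIGEONHOLE FORM**: for `V` smooth on `GL_n(F)` with `r_B V` finite-dimensional and IRREDUCIBLE subrepresentations `N₁, N₂`, if for some `η` the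
multiplicities of `N₁` and `N₂` together EXCEED that of `V` (`mult V η < mult N₁ η + mult N₂ η`), then `N₁ = N₂` (else `N₁ ⊓ N₂ = ⊥`, §1, and the previous
theorem). [cite: BernsteinZelevinsky1977, Cor. 2.13, §2.3] [cite: Casselman1995, §6.3] -/
theorem eq_of_finrank_weightSpace_lt_add (hV : V.IsSmooth) [FiniteDimensional ℂ (restrictUnipotentGL F (id : Fin n → Fin n) V).Coinvariants]
    {N₁ N₂ : Subrepresentation V} [N₁.toRepresentation.IsIrreducible] [N₂.toRepresentation.IsIrreducible]
    (η : (Π a : Fin n, GL {i : Fin n // (id : Fin n → Fin n) i = a} F) → ℂ)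
    (h : finrank ℂ ↥(⨅ m, Module.End.maxGenEigenspace (normalizedJacquetGL F (id : Fin n → Fin n) V m) (η m)) <
      finrank ℂ ↥(⨅ m, Module.End.maxGenEigenspace (normalizedJacquetGL F (id : Fin n → Fin n) N₁.toRepresentation m) (η m)) +
        finrank ℂ ↥(⨅ m, Module.End.maxGenEigenspace (normalizedJacquetGL F (id : Fin n → Fin n) N₂.toRepresentation m) (η m))) :
    N₁ = N₂ := by
  rcases inf_eq_bot_or_eq_of_isIrreducible V N₁ N₂ with hinf | h12
  · exact absurd (finrank_weightSpace_add_le_of_inf_eq_bot V hV hinf η) (not_le.2 h)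
  · exact h12

end Pigeonhole

end Summit.HodgeConjecture.HodgeConjecture.Cruxes.H413.K2E3GL3WeightOneUniqueness

end
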